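import Summits.CriticalPhenomena.PercolationContinuityZ3.Theorems.PercNearOneGluingNoHeavyLowerTailThreePointProductFormFibreTwoPortSubstitution
import HarnessLib

/-!
# The product form in the fibre language: two-terminal substitution, pointwise part for the counts `w` and `J` of the system 𝒮
# (Sahi programme, prover prim-sahi-p2 gen 56)

Support file (`--supports stmt-CriticalPhenomena-4575`, helper); companion of `…ThreePointProductFormFibreTwoPortSubstitution` (gen 55: `bad_iff_restBad`,
`sa_iff_rest`).  Standard axioms, no sorries, no named facts, no definitions.  Memo `run/shared/lean/prim/prim-sahi/FROM-prim-sahi-p2-gen56-REFINED-PRODUCT-FORM.md` §9(0), §10.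

In the setting of R4 (terminal-free network with interior `Nv`, ports `p, q`; `Rr z e` = rest connection with the virtual edge iff `e`; `Fl z e` = rest flat;
`Fn z πp πq` = network flip), the two further events of the system `𝒮 = {(P), (S1J), (S1J′)}` are rest events exactly like `bad` and `P1`:
* **`w_iff_restW`** [this work] — `[(a ↔ s ∧ a ↮ c in z) ∧ s ↔ c in ♭ₐz]` iff `(Rr z e a s ∧ ¬Rr z e a c) ∧ (s ↔ c in Fl z e with the virtual edge iff e′)`
  (the proof of `bad_iff_restBad` verbatim: the flat part does not use the type);
* **`joined_iff_rest`** [this work] — `(a ↔ s ∧ a ↔ c in z)` iff `(Rr z e a s ∧ Rr z e a c)`.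
Hence (memo §10; numerically exact on 102 glued instances) `w`, `w′`, `J` are substitution-linear with the same interface weights `A, Cn − A, Dn − Cn + A`
as `bad, P1, P2` — the counting half (`card_w_substitution`) is left to the successor (spec: memo §9(0)).
[folklore] (walks through a separator); [cite: Gladkov2024, Conjecture 10.1 (p. 18), arXiv:2408.08457] for CONJECTURE (P) served.
-/

namespace Summit.CriticalPhenomena.PercolationContinuityZ3.Theorems.ProductFormFibre

open Finset Literature.Probability.Percolation
open Summit.CriticalPhenomena.PercolationContinuityZ3.Theorems.ThreePointCPIClusterSwap (clusterFlip)

variable {V α : Type*}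

section SubstitutionS1J

variable (ends : α → Sym2 V) (p q a : V) (Nv : Set V) (inN : α → Prop)
  (hN1 : ∀ l, inN l → ∀ v ∈ ends l, v ∈ Nv ∨ v = p ∨ v = q) (hN2 : ∀ l, ¬ inN l → ∀ v ∈ ends l, v ∉ Nv)
  (hp : p ∉ Nv) (hq : q ∉ Nv) (ha : a ∉ Nv)
  (zn zr : (α → Bool) → α → Bool)
  (hzn : ∀ z l, inN l → zn z l = z l) (hzn0 : ∀ z l, ¬ inN l → zn z l = false)
  (hzr : ∀ z l, ¬ inN l → zr z l = z l) (hzr0 : ∀ z l, inN l → zr z l = false)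
  (Rr : (α → Bool) → Bool → V → V → Prop)
  (hRr : ∀ z e u v, Rr z e u v ↔
    ((openGraph (labelledOpen ends (zr z))).Reachable u v ∨
      (e = true ∧ (((openGraph (labelledOpen ends (zr z))).Reachable u p ∧ (openGraph (labelledOpen ends (zr z))).Reachable q v) ∨
        ((openGraph (labelledOpen ends (zr z))).Reachable u q ∧ (openGraph (labelledOpen ends (zr z))).Reachable p v)))))
  (Fl : (α → Bool) → Bool → α → Bool)
  (hFl1 : ∀ z e l, ¬ inN l → (∃ v ∈ ends l, Rr z e a v) → Fl z e l = !z l)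
  (hFl2 : ∀ z e l, ¬ inN l → ¬ (∃ v ∈ ends l, Rr z e a v) → Fl z e l = z l)
  (hFl0 : ∀ z e l, inN l → Fl z e l = false)
  (Fn : (α → Bool) → Bool → Bool → α → Bool)
  (hFn1 : ∀ z πp πq l, inN l →
    ((πp = true ∧ ∃ v ∈ ends l, (openGraph (labelledOpen ends (zn z))).Reachable p v) ∨
      (πq = true ∧ ∃ v ∈ ends l, (openGraph (labelledOpen ends (zn z))).Reachable q v)) → Fn z πp πq l = !z l)
  (hFn2 : ∀ z πp πq l, inN l →
    ¬ ((πp = true ∧ ∃ v ∈ ends l, (openGraph (labelledOpen ends (zn z))).Reachable p v) ∨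
      (πq = true ∧ ∃ v ∈ ends l, (openGraph (labelledOpen ends (zn z))).Reachable q v)) → Fn z πp πq l = z l)
  (hFn0 : ∀ z πp πq l, ¬ inN l → Fn z πp πq l = false)

include hN1 hN2 hp hq ha hzn hzn0 hzr hzr0 hRr hFl1 hFl2 hFl0 hFn1 hFn2 hFn0 in
/-- **`w` is a rest event.**  With the true values `e, πp, πq, e′` (as in `bad_iff_restBad`) and terminals `s, c ∉ Nv`:
`[(a ↔ s ∧ a ↮ c in z) ∧ s ↔ c in ♭ₐz]` iff `(Rr z e a s ∧ ¬Rr z e a c) ∧ (s ↔ c in Fl z e, with the virtual edge pq iff e′)`. [this work] -/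
theorem w_iff_restW (z : α → Bool) (e πp πq e' : Bool) {s c : V} (hs : s ∉ Nv) (hc : c ∉ Nv)
    (he : (openGraph (labelledOpen ends (zn z))).Reachable p q ↔ e = true)
    (hπp : Rr z e a p ↔ πp = true) (hπq : Rr z e a q ↔ πq = true)
    (he' : (openGraph (labelledOpen ends (Fn z πp πq))).Reachable p q ↔ e' = true) :
    (((openGraph (labelledOpen ends z)).Reachable a s ∧ ¬ (openGraph (labelledOpen ends z)).Reachable a c) ∧
      (openGraph (labelledOpen ends (clusterFlip ends a fun x => !z x))).Reachable s c) ↔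
    ((Rr z e a s ∧ ¬ Rr z e a c) ∧
      ((openGraph (labelledOpen ends (Fl z e))).Reachable s c ∨
        (e' = true ∧ (((openGraph (labelledOpen ends (Fl z e))).Reachable s p ∧ (openGraph (labelledOpen ends (Fl z e))).Reachable q c) ∨
          ((openGraph (labelledOpen ends (Fl z e))).Reachable s q ∧ (openGraph (labelledOpen ends (Fl z e))).Reachable p c))))) := by
  have hR := fun {u v : V} (hu : u ∉ Nv) (hv : v ∉ Nv) =>
    reachable_iff_Rr ends p q Nv inN hN1 hN2 zn zr hzn hzn0 hzr hzr0 Rr hRr z e he hu hv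
  have hparts := flat_eq_parts ends p q a Nv inN hN1 hN2 hp hq ha zn zr hzn hzn0 hzr hzr0 Rr hRr Fl hFl1 hFl2 Fn hFn1 hFn2 z e πp πq he hπp hπq
  have hw := reachable_twoPort_iff ends p q Nv inN hN1 hN2 (z := clusterFlip ends a fun x => !z x) (zn := Fn z πp πq) (zr := Fl z e)
    (fun l hl => ((hparts l).1 hl).symm) (fun l hl => hFn0 z πp πq l hl)
    (fun l hl => ((hparts l).2 hl).symm) (fun l hl => hFl0 z e l hl) hs hc
  rw [hR ha hs, hR ha hc, hw, he']

include hN1 hN2 ha hzn hzn0 hzr hzr0 hRr in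
/-- **`J = {a ↔ s, a ↔ c}` is the rest event with the true virtual edge `e`.** [this work] -/
theorem joined_iff_rest (z : α → Bool) (e : Bool) {s c : V} (hs : s ∉ Nv) (hc : c ∉ Nv)
    (he : (openGraph (labelledOpen ends (zn z))).Reachable p q ↔ e = true) :
    ((openGraph (labelledOpen ends z)).Reachable a s ∧ (openGraph (labelledOpen ends z)).Reachable a c) ↔
    (Rr z e a s ∧ Rr z e a c) := by
  rw [reachable_iff_Rr ends p q Nv inN hN1 hN2 zn zr hzn hzn0 hzr hzr0 Rr hRr z e he ha hs,
    reachable_iff_Rr ends p q Nv inN hN1 hN2 zn zr hzn hzn0 hzr hzr0 Rr hRr z e he ha hc]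

end SubstitutionS1J

end Summit.CriticalPhenomena.PercolationContinuityZ3.Theorems.ProductFormFibre
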